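import Summits.ResolutionOfSingularities.ResolutionOfSingularities.Theorems.PurelyInseparableDim4ResConeLightTailThreeFive
import Summits.ResolutionOfSingularities.ResolutionOfSingularities.Theorems.PurelyInseparableDim4ResConeLightPairWeights
import Summits.ResolutionOfSingularities.ResolutionOfSingularities.Theorems.PurelyInseparableDim4ResConeLightPairDichotomy
import HarnessLib
import HarnessLib.Audit.Tags

/-!
# Purely inseparable four-folds — the LIGHT `d = 4` TAIL at `p = 5` (K28d): weights `(1, 1)`, the pair dichotomy,
# (T1) free tail ✗, the C∞ branch by value (K2(p) lane, slice B; cell `res-dim4-pi`)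

[OURS · counted 0 · cell `res-dim4-pi` · K2(p) lane holder res-dim4-p-12 g3's brick (K28d) «the `d = 4` analogue of
K27a» by signature (bus 2026-08-29 02:23Z), seat res-dim4-p-2 g4 (lineage res-dim4-p-2).]  Nothing here proves
K2(5): this file closes the `d = 4` light power-cone regime at `p = 5` MODULO the C∞ branch — two stretch-born
boundary letters of weight `1` from some `k₁` on — taken BY VALUE as the hypothesis `hγ` until the K24b frame/game
assembly (res-dim4-typ-1 g2 / res-dim4-p-2 g4 / res-dim4-p-9 g3 / res-dim4-p-3 g3) lands; the `d = 2`, `d = 3`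
regimes and the binary-cone slice are separate.  Nothing here proves `NoIsolatedTrap 5 5` or resolution of
singularities in dimension ≥ 4 / characteristic `p`.  AI kernel work, weaker than expert review.

**`no_light_powerCone_tail_four_five_of`** (`p = 5`, `d = 4`): from the slice-B chain block (witnessed isolated
above-floor `Step0 5` chain, `x^{r₀} ∣ F₀`, shade `4` and `e_G = 3` from `k₀`) and `hγ`: `False`.  Route:
`chain_powerCone_package` ⇒ every satellite step light (K27a `satellite_light_of_powerCone`) ⇒ K28 (a)
`light_pair_weights` (weights `≤ 1`, `|r| = 2` from `k₀`: `hwt`) and `light_pair_card_two` ⇒ K28 (b)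
`light_pair_dichotomy` ⇒ (T1) the free-tail theorem `FreeTailProof.noIsolatedFreeTailAt_self` · (T2′) `hγ k₁ hwt hborn`.
bears_on: LADDER-RESOLUTION:D157-DOOR2 (res-dim4-pi · K2(p) · slice B · K28d).  Supports
stmt-ResolutionOfSingularities-16155 (helper).
-/

set_option linter.dupNamespace false -- mandated namespace of this single-conjunct summit

noncomputable section

namespace Summit.ResolutionOfSingularities.ResolutionOfSingularities.Theorems.PIDim4

namespace ResCone

open MvPolynomial Finset
open Literature.AlgebraicGeometry.Resolution
open Literature.AlgebraicGeometry.Resolution.CentreBlowup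
open Literature.AlgebraicGeometry.Resolution.Hauser2010
open Literature.AlgebraicGeometry.Resolution.HauserPerlega2019
open PointBlowup (polarMap additiveSubspace direction)

variable {K : Type} [Field K]

/-- **THE LIGHT `d = 4` TAIL AT `p = 5`, MODULO THE C∞ BRANCH** (K28d; statement in the module docstring): a
witnessed isolated above-floor `Step0 5` chain with `x^{r₀} ∣ F₀` cannot have shade `4` and `e_G = 3` from some index
on — GIVEN, by value, that the C∞ configuration (weights `(1, 1)` from `k₀`, both boundary letters stretch-born from
some `k₁ ≥ k₀`) is contradictory on this chain. [OURS] [cite: CossartJannsenSaito2020, Thm. 3.10(4), Thm. 3.14] -/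
theorem no_light_powerCone_tail_four_five_of [CharP K 5] [DecidableEq K] {c : ℕ → State K} {j : ℕ → Fin 4}
    {b : ℕ → Fin 4 → K} (hc : ∀ k, IsIsolated 5 (c k).F ∧ Step0 5 (c k) (c (k + 1)))
    (hw : FreeTail.IsWitnessedChain 5 c j b) (hr0 : ∀ e ∈ (c 0).F.support, (c 0).r ≤ e)
    (hfloor : ∀ k, ordZero (c k).F ≠ (5 : ℕ)) {k₀ : ℕ} (hshade : ∀ k, k₀ ≤ k → (c k).shade = ((4 : ℕ) : ℕ∞))
    (he3 : ∀ k, k₀ ≤ k → Module.finrank K (resVertex (c k)) = 3)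
    (hγ : ∀ k₁ : ℕ, k₀ ≤ k₁ → (∀ k, k₀ ≤ k → (∀ i, (c k).r i ≤ 1) ∧ (c k).r.degree = 2) →
      (∀ k, k₁ ≤ k → ∀ i, 1 ≤ (c k).r i →
        ∃ t, k₀ ≤ t ∧ t < k ∧ j t = i ∧ ∀ m, t < m → m < k → j m ≠ i ∧ b m i = 0) → False) : False := by
  haveI : Fact (Nat.Prime 5) := ⟨by norm_num⟩
  -- the frame data of the power-cone stretch
  obtain ⟨ℓ, a0, lam, hpkg⟩ := chain_powerCone_package 5 hc hw hr0 hfloor (by norm_num) hshade he3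
  have hform : ∀ k, k₀ ≤ k → resForm (c k) = C (a0 k) * (∑ i, C (ℓ k i) * X i) ^ 4 :=
    fun k hk => (hpkg k hk).2.2.1
  have hdir : ∀ k, k₀ ≤ k → ℓ k (j k) + dotProduct (ℓ k) (b k) = 0 := fun k hk => (hpkg k hk).2.2.2.1
  have hlam : ∀ k, k₀ ≤ k → lam k ≠ 0 := fun k hk => (hpkg k hk).2.2.2.2.1
  have hprop : ∀ k, k₀ ≤ k → ∀ i, i ≠ j k → ℓ (k + 1) i = lam k * ℓ k i :=
    fun k hk => (hpkg k hk).2.2.2.2.2.1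
  have hcarry : ∀ k, k₀ ≤ k → ∃ i, i ≠ j k ∧ ℓ k i ≠ 0 := fun k hk => (hpkg k hk).2.2.2.2.2.2
  -- every satellite step is light
  have hlight : ∀ k, k₀ ≤ k → FreeTail.IsSatellite j b k → ∀ oₖ oₖ₁ : ℕ,
      ordZero (c k).F = oₖ → ordZero (c (k + 1)).F = oₖ₁ → oₖ + oₖ₁ + 3 ≤ 15 := by
    intro k hk hsat oₖ oₖ₁ hoₖ hoₖ₁
    have h := satellite_light_of_powerCone 5 hc hw hr0 hfloor (by norm_num) (by norm_num) hshade hform hdir hlam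
      hprop hcarry hk hsat hoₖ hoₖ₁
    omega
  have hfloor' : ∀ k, ordZero (c k).F ≠ 5 := fun k => by have h := hfloor k; exact_mod_cast h
  have hFT : ∀ k₁, (∀ k, k₁ ≤ k → ¬ FreeTail.IsSatellite j b k) → False := fun k₁ hfree => by
    obtain ⟨k, hk⟩ := FreeTailProof.noIsolatedFreeTailAt_self 5 K c j b k₁ hw hfree
    exact hk (hc k).1
  -- K28 (a): weights `(1, 1)`; K28 (b): the pair dichotomy
  have hwt := light_pair_weights hc hw hfloor' hshade hlight
  have hB2 : ∀ k, k₀ ≤ k → (c k).r.support.card = 2 :=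
    fun k hk => light_pair_card_two hc hw hfloor' hshade hlight hk
  rcases light_pair_dichotomy 5 hc hw hfloor hB2 with ⟨k₁, -, hfree⟩ | ⟨k₁, hk₁, hborn⟩
  · exact hFT k₁ hfree
  · exact hγ k₁ hk₁ hwt hborn

end ResCone

end Summit.ResolutionOfSingularities.ResolutionOfSingularities.Theorems.PIDim4

end
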